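import Summits.BirchSwinnertonDyer.BirchSwinnertonDyer.Theses.InertBadSignedBranches
import Literature.NumberTheory.EllipticCurves.GlobalMinimalModel
import HarnessLib

/-!
# Sketch (crux idea `tame-descent-j1728`, ideator bsd-idea-18 g5, lens = transfer) for crux
# `InertBadAtThree` (stmt-BirchSwinnertonDyer-19225), stub `stub_maninAtThree` of line `bed_at_three`

Nothing here proves BSD, the crux, or the stub.  This file only TYPES the first checkable statements of
the idea over existing declarations and checks that the imported pieces compose.

The III/III* half of `ManinAtThree` (the `j = 1728` quartic-twist family `y² = x³ + D x`, `v₃(D)` odd,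
`9 ∥ N`) is, curve-side, a corner of crux `ManinPrimeToThreeAtNine` (stmt-22968) — cell bsd-f2-manin's
TAME DESCENT identity (II₃) `4·ord₃(c) = a + b − k` over `R' = ℤ₃^nr[3^{1/4}]` (MEMO-imc §19.11, card
`Cruxes/ManinPrimeToThreeAtNine/Ideas/tame-descent-canonical-subgroup-3.md`, audited ref1 §R51).  The two
sub-cell statements E-imc-57 / E-imc-59 of that cell are restated VERBATIM below (they live in the cell's
HOME sketch `imc/Sketch-imc-g13b.lean`, namespace `BsdF2ManinImcG13b`, not in the tree).  L1/L1′ are the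
new first lemmas (pure algebra of the `c₆ = 0` family) placing the family inside their selectors; the edge
`maninAtThreeQuartic_of` is kernel-checked.  The idea card records the one NON-TRANSFERRING step of the
tame-descent dictionary (Néron-smoothness of the A-optimal quotient over `R'`, where Raynaud's `e < p − 1`
fails: `e = 4`, `p = 3`), which these Props silently contain.
-/

namespace Summit.BirchSwinnertonDyer.BirchSwinnertonDyer.Cruxes.InertBadAtThree.TameDescentJ1728

open Literature.NumberTheory.EllipticCurves Literature.NumberTheory.EllipticCurves.ModularForms

/-- bsd-f2-manin E-imc (g13b) selector, verbatim: potentially good and «deep» via `c₄`. -/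
def PotGoodDeepC4 (W : WeierstrassCurve ℚ) : Prop := W.c₄ = 0 ∨ 3 ≤ padicValRat 3 W.c₄

/-- bsd-f2-manin E-imc (g13b) selector, verbatim: «deep» type III at 3, closed form `9 ∣ b₂ − 12 b₆`. -/
def DeepIII (W : WeierstrassCurve ℚ) : Prop :=
  W.b₂ - 12 * W.b₆ = 0 ∨ 2 ≤ padicValRat 3 (W.b₂ - 12 * W.b₆)

/-- E-imc-57 `TameThreeStarredOptimalManinUnit`, verbatim (cell bsd-f2-manin, imc g13b): lattice-optimal,
`9 ∥ N`, type III* (`v₃ Δ_min = 9`, pot. good) ⇒ `3 ∤ c`.  THEOREM-candidate of that cell modulo its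
dictionary D1₃–D6 — see the idea card for the hidden hypothesis (S). -/
def TameThreeStarredOptimalManinUnit : Prop :=
  ∀ (W : WeierstrassCurve ℚ) [W.IsElliptic] [W.IsGloballyMinimal] {N : ℕ} [NeZero N]
    (D : ModularParametrizationData W N),
    (∀ z ∈ D.L.lattice, ∃ w ∈ periodLattice D.f, z = D.c * w) → 3 ^ 2 ∣ N → ¬ 3 ^ 3 ∣ N →
      padicValInt 3 W.minimalDiscriminantInt = 9 → PotGoodDeepC4 W → ¬ (3 : ℤ) ∣ D.maninConstant

/-- E-imc-59 `TameThreeDeepIIIOptimalManinUnit`, verbatim (cell bsd-f2-manin, imc g13b): lattice-optimal,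
`9 ∥ N`, deep type III ⇒ `3 ∤ c`.  Same status as E-imc-57. -/
def TameThreeDeepIIIOptimalManinUnit : Prop :=
  ∀ (W : WeierstrassCurve ℚ) [W.IsElliptic] [W.IsGloballyMinimal] {N : ℕ} [NeZero N]
    (D : ModularParametrizationData W N),
    (∀ z ∈ D.L.lattice, ∃ w ∈ periodLattice D.f, z = D.c * w) → 3 ^ 2 ∣ N → ¬ 3 ^ 3 ∣ N →
      padicValInt 3 W.minimalDiscriminantInt = 3 → DeepIII W → ¬ (3 : ℤ) ∣ D.maninConstant

/-- **L1 (FIRST LEMMA of the idea; pure algebra, provable).** On a globally minimal model with `c₆ = 0`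
(`j = 1728`) and `v₃ Δ_min = 3` (Kodaira III at 3) the cell's «deep» selector holds: from `c₆ = 0`,
`1728 Δ = c₄³` one gets `v₃ c₄ = 2`, then `3 ∣ b₂ =: 3β`, `3 ∣ b₄`, and `β³ = 4βb₄ − 8b₆` gives
`β ≡ b₆ (mod 3)`, i.e. `9 ∣ b₂ − 12 b₆`.  (Conceptually: `y² = x³ + u x` has Hasse invariant `≡ 0 (mod 3)`,
so the whole quartic family is deep — it never meets the cell's shallow-III residual E-imc-60.) -/
def J1728DeepIII : Prop :=
  ∀ (W : WeierstrassCurve ℚ) [W.IsElliptic] [W.IsGloballyMinimal],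
    W.c₆ = 0 → padicValInt 3 W.minimalDiscriminantInt = 3 → DeepIII W

/-- **L1′ (pure algebra, provable).** `c₆ = 0` and `v₃ Δ_min = 9` (Kodaira III* at 3) ⇒ `v₃ c₄ = 4 ≥ 3`. -/
def J1728Starred : Prop :=
  ∀ (W : WeierstrassCurve ℚ) [W.IsElliptic] [W.IsGloballyMinimal],
    W.c₆ = 0 → padicValInt 3 W.minimalDiscriminantInt = 9 → PotGoodDeepC4 W

/-- The III/III* (`j = 1728`, i.e. `c₆ = 0`) half of stub `ManinAtThree` of line `bed_at_three`, with the
local selectors explicit (`9 ∥ N`, `v₃ Δ_min ∈ {3, 9}`); binder block and lattice clause exactly those of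
`InertBadSignedBranches`/`bed_at_three.ManinAtThree` at `p = 3`.  Joined to `ManinAtThree` by the I₀* cell
(tree: `WAll.maninDatum_of_kodairaSymbolAt_eq_Istar`) and the selector law «CM ∧ CM-inert 3 ∧ bad at 3 ⇒
I₀*, or c₆ = 0 with type III/III*» (Tate's algorithm; bsd-f2-manin census). -/
def ManinAtThreeQuartic : Prop :=
  ∀ (W : WeierstrassCurve ℚ) [W.IsElliptic] [W.IsGloballyMinimal] [NeZero (W.conductorNorm ℤ)]
    (D : ModularParametrizationData W (W.conductorNorm ℤ)),
    (∀ z ∈ D.L.lattice, ∃ w ∈ periodLattice D.f, z = D.c * w) →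
    3 ^ 2 ∣ W.conductorNorm ℤ → ¬ 3 ^ 3 ∣ W.conductorNorm ℤ → W.c₆ = 0 →
    (padicValInt 3 W.minimalDiscriminantInt = 3 ∨ padicValInt 3 W.minimalDiscriminantInt = 9) →
      ¬ (3 : ℤ) ∣ D.c

/-- EDGE (kernel-checked, no sorry): the two bsd-f2-manin sub-cell statements plus L1/L1′ give the
III/III* half of `ManinAtThree`. -/
theorem maninAtThreeQuartic_of (h57 : TameThreeStarredOptimalManinUnit)
    (h59 : TameThreeDeepIIIOptimalManinUnit) (hL1 : J1728DeepIII) (hL1' : J1728Starred) :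
    ManinAtThreeQuartic := by
  intro W _ _ _ D hopt h9 h27 hc6 hΔ
  rcases hΔ with h3 | h9'
  · exact h59 W D hopt h9 h27 h3 (hL1 W hc6 h3)
  · exact h57 W D hopt h9 h27 h9' (hL1' W hc6 h9')


/-! ## Bridge to the skeleton of record (`Lines/bed_at_three.lean` v3, sha16 `2c65c7999368d398`,
stub `BedAtThree.ManinAtThreeQuartic`), restated VERBATIM below so that this sketch does not import a
`Cruxes/…/Lines` module.  Two dictionary glue statements join the stub's selectors (`j = 1728`, Kodaira
`III/III*` at the place over `3`) to the cell selectors used above (`c₆ = 0`, `9 ∥ N`, `v₃ Δ_min ∈ {3,9}`):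
`c₆_eq_zero_of_j_eq_1728` is PROVED here; `KodairaIIIAtThreeGlue` is left as a named hypothesis
(provable from the tree's Tate-algorithm facts `conductorExponent_eq_two_of_kodairaSymbolAt`,
`ordMinimalDiscriminant_eq_numComponentsAt_add_one_of_kodairaSymbolAt`, `numComponents III = 2 / III* = 8`,
and `conductorNorm = ∏ p ^ f_p`; support-level, not a crux). -/

/-- `j = 1728 ⇒ c₆ = 0` over `ℚ` (from `j = c₄³/Δ` and `1728 Δ = c₄³ − c₆²`). -/
theorem c₆_eq_zero_of_j_eq_1728 (W : WeierstrassCurve ℚ) [W.IsElliptic] (hj : W.j = 1728) :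
    W.c₆ = 0 := by
  have h1 : W.c₄ ^ 3 = W.Δ * 1728 := by
    have h := hj
    rw [WeierstrassCurve.j, Units.inv_mul_eq_iff_eq_mul, WeierstrassCurve.coe_Δ'] at h
    exact h
  have h2 := W.c_relation
  have h3 : W.c₆ ^ 2 = 0 := by linear_combination h1 + h2
  exact (pow_eq_zero_iff two_ne_zero).mp h3

/-- Dictionary glue (support-level, hypothesis here): at the place `v` of `ℤ` over `3`, Kodaira type
`III` or `III*` of a globally minimal model forces `f₃ = 2` (`9 ∥ N`) and `v₃ Δ_min = 3` resp. `9`. -/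
def KodairaIIIAtThreeGlue : Prop :=
  ∀ (W : WeierstrassCurve ℚ) [W.IsElliptic] [W.IsGloballyMinimal] (v : IsDedekindDomain.HeightOneSpectrum ℤ),
    Rat.HeightOneSpectrum.natGenerator v = 3 →
    (W.kodairaSymbolAt v = Literature.NumberTheory.DiophantineGeometry.KodairaSymbol.III ∨
      W.kodairaSymbolAt v = Literature.NumberTheory.DiophantineGeometry.KodairaSymbol.IIIstar) →
    3 ^ 2 ∣ W.conductorNorm ℤ ∧ ¬ 3 ^ 3 ∣ W.conductorNorm ℤ ∧
      (padicValInt 3 W.minimalDiscriminantInt = 3 ∨ padicValInt 3 W.minimalDiscriminantInt = 9)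

/-- VERBATIM copy of stub `ManinAtThreeQuartic` of `Cruxes/InertBadAtThree/Lines/bed_at_three.lean`
(namespace `…Cruxes.InertBadAtThree.BedAtThree`, v3 `2c65c7999368d398`). -/
def BedManinAtThreeQuartic : Prop :=
  ∀ (W : WeierstrassCurve ℚ) [W.IsElliptic] [W.IsGloballyMinimal] [NeZero (W.conductorNorm ℤ)] (p : ℕ) [Fact p.Prime] (D : Literature.NumberTheory.EllipticCurves.ModularForms.ModularParametrizationData W (W.conductorNorm ℤ)) (v : IsDedekindDomain.HeightOneSpectrum ℤ), Rat.HeightOneSpectrum.natGenerator v = p → W.HasCM → W.analyticRank = 1 → p = 3 → Literature.NumberTheory.EllipticCurves.Rank1Residual.CMInert W p → ¬ Literature.NumberTheory.EllipticCurves.Rank1Residual.Good W p → (∀ z ∈ D.L.lattice, ∃ w ∈ Literature.NumberTheory.EllipticCurves.ModularForms.periodLattice D.f, z = D.c * w) → (W.j = 1728 ∧ (W.kodairaSymbolAt v = Literature.NumberTheory.DiophantineGeometry.KodairaSymbol.III ∨ W.kodairaSymbolAt v = Literature.NumberTheory.DiophantineGeometry.KodairaSymbol.IIIstar)) → ¬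 (p : ℤ) ∣ D.c

/-- **Edge to the stub BY TEXT**: E-imc-57 → E-imc-59 → L1 → L1′ → (Kodaira glue) → `BedAtThree.ManinAtThreeQuartic`
(verbatim).  No sorry; the CM / rank / CM-inert hypotheses of the stub are not even used — the Manin
statement is a property of the quartic cell `j = 1728`, `III/III*` at `3`, lattice-optimal. -/
theorem bedManinAtThreeQuartic_of (h57 : TameThreeStarredOptimalManinUnit)
    (h59 : TameThreeDeepIIIOptimalManinUnit) (hL1 : J1728DeepIII) (hL1' : J1728Starred)
    (hK : KodairaIIIAtThreeGlue) : BedManinAtThreeQuartic := by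
  intro W _ _ _ p _ D v hv _hCM _hrk hp _hin _hng hopt hjk
  subst hp
  obtain ⟨hj, hks⟩ := hjk
  obtain ⟨h9, h27, hΔ⟩ := hK W v hv hks
  have h := maninAtThreeQuartic_of h57 h59 hL1 hL1' W D hopt h9 h27 (c₆_eq_zero_of_j_eq_1728 W hj) hΔ
  exact_mod_cast h

end Summit.BirchSwinnertonDyer.BirchSwinnertonDyer.Cruxes.InertBadAtThree.TameDescentJ1728
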